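import Summits.HodgeConjecture.HodgeConjecture.Theorems.MarkmanPartnerTransportRMTypeOrbitSymmetries
import HarnessLib

/-!
# Route MarkmanPartnerTransport · crux `PicardThreeK3Squares` (stmt-HodgeConjecture-19652) —
# «RATIONAL ORBIT DENSITY» 2/4: model vectors and the action of `R_{θu} ⊗ ℂ` on the `e`-eigenspace

Cell hodge-nonav, crux #4 of route MarkmanPartnerTransport (HC⁴(S ⊗ S) for projective K3 surfaces with
ρ(S) ≥ 3; open core: real multiplication). Programme «RATIONAL ORBIT DENSITY» (prover seat
hodge-nonav-19652-p1, gen 10; `--supports stmt-HodgeConjecture-19652`, helper): the cell's moduli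
programme displays, per rational real-multiplication type `θ ∈ M₂₂(ℚ)` (`…RMTypeDefs`), the input
`RMTypeDominated θ` — an `RMSpreadFamily` at EVERY `θ`-eigen period, whose intended discharge needs the
universal family over the RM component plus Deligne's invariant-cycle theorem («moduli carriers do not
exist»). The programme replaces it by the WEAKER input «`θ` is cycle-induced at the marked K3 surfaces
whose periods lie in some non-empty OPEN subset of the Hodge locus `D_{θ,e}`», through the elementary
fact proved in this series: **the rational centraliser `G_θ(ℚ) = {g ∈ O(Λ_ℚ) : gθ = θg}` has dense
orbits on `D_{θ,e} = {y ∈ Λ_ℂ : θ_ℂ y = e y, (y.y) = 0, (ȳ.y) > 0}`**, while HC⁴ ∕ cycle-inducedness of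
`θ` is `G_θ(ℚ)`-invariant by Buskin transport (the pattern of `RMTypeDescent`, p620943).

THIS FILE (fact-free): for `u ∈ Λ_ℚ` the MODEL VECTOR `w_u := π(θ_ℂ)(θ_ℂ u)` (`modelVec`), where
`π ∈ ℂ[X]` is the type's eigenprojector certificate (`π(e) = 1`, `(θ_ℂ − e)·π(θ_ℂ)·θ_ℂ = 0`):
`w_u` is an `e`-eigenvector in the complex cyclic subspace `ℂ[θ_ℂ]·(θu)`;
`nondegenerate_restrict_cycQ` — `k3FormRat` is NON-DEGENERATE on `Z_{θu} = ℚ[θ]·θu` as soon as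
`(w_u.w_u) ≠ 0` and (`hT`, Hodge index in the application) the rational vectors of `θ(Λ_ℚ)` orthogonal
to the `e`-eigenspace contain no non-zero isotropic vector; `ratSymmC_apply_of_eigen` — **on the
`e`-eigenspace of `θ_ℂ` the rational symmetry `R_{θu} ⊗ ℂ` IS the reflection along `w_u`**. No named
fact, no sorry; nothing here says HC is proved.

References: O'Meara, *Introduction to Quadratic Forms* (1963), §42–§43B (symmetries); Iversen,
*Hyperbolic Geometry* (1992), Ch. I §2 Prop. 2.3; Huybrechts, *Lectures on K3 Surfaces* (2016), Ch. 3
Lemma 3.1, Ch. 6 Prop. 1.5 and Rem. 3.3; Lang, *Algebra* (2002), Ch. XIV §2–§3, XV §6–§7, XVI §4; van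
Geemen–Schütt, Forum Math. Sigma 13 (2025) e2, §2.1, §3.4; Buskin, J. reine angew. Math. 755 (2019), §6.2.
-/

set_option linter.dupNamespace false

noncomputable section

namespace Summit.HodgeConjecture.HodgeConjecture.Theorems.MarkmanPartnerTransport.RMTypeOrbit

open Polynomial
open Literature.AlgebraicGeometry.Surfaces Literature.LinearAlgebra.QuadraticForm
open Summit.HodgeConjecture.HodgeConjecture.Theorems.MarkmanPartnerTransport.RMTypeDescent

section K3

variable {θ : Matrix K3Index K3Index ℚ} {v : K3Index → ℚ}
  (hZ : (k3FormRat.restrict (cycQ θ v)).Nondegenerate)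

/-! ### §4 The model vectors `w_u = π(θ_ℂ)(θ_ℂ u)` and the cyclic subspaces over `ℂ` -/

/-- Casting commutes with iterates of `θ`. [cite: Huybrechts2016K3, Ch. 6 Rem. 3.3] -/
theorem ratCast_pow_toLin'_apply (u : K3Index → ℚ) (k : ℕ) :
    (fun i => (((Matrix.toLin' θ ^ k) u) i : ℂ)) = (thetaC θ ^ k) (fun i => (u i : ℂ)) := by
  induction k with
  | zero => simp
  | succ k ih =>
    rw [pow_succ', Module.End.mul_apply, pow_succ', Module.End.mul_apply, ← ih, Matrix.toLin'_apply,
      thetaC_ratCast]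

/-- The image of `Z_v` lies in the complex cyclic subspace `ℂ[θ_ℂ]·v`. [cite: Lang2002, Ch. XVI §4 (extension of the base)] -/
theorem ratCast_mem_cyclicSpan_of_mem {v z : K3Index → ℚ} (hz : z ∈ cycQ θ v) :
    (fun i => (z i : ℂ)) ∈ cyclicSpan (thetaC θ) (fun i => (v i : ℂ)) := by
  induction hz using Submodule.span_induction with
  | mem x hx =>
    obtain ⟨k, rfl⟩ := hx
    rw [ratCast_pow_toLin'_apply]
    exact pow_apply_mem_cyclicSpan _ _ k
  | zero =>
    have h0 : (fun i => ((0 : K3Index → ℚ) i : ℂ)) = 0 := by funext i; simp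
    rw [h0]; exact Submodule.zero_mem _
  | add x y _ _ hx hy =>
    have h : (fun i => ((x + y) i : ℂ)) = (fun i => (x i : ℂ)) + fun i => (y i : ℂ) := by
      funext i; simp
    rw [h]; exact Submodule.add_mem _ hx hy
  | smul a x _ hx =>
    have h : (fun i => ((a • x) i : ℂ)) = (a : ℂ) • fun i => (x i : ℂ) := by
      funext i; simp
    rw [h]; exact Submodule.smul_mem _ _ hx

/-- `R_v ⊗ ℂ = −1` on the complex cyclic subspace `ℂ[θ_ℂ]·v`. [cite: Omeara1963, §42] -/
theorem ratSymmC_apply_of_mem_cyclicSpan {y : K3Index → ℂ}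
    (hy : y ∈ cyclicSpan (thetaC θ) (fun i => (v i : ℂ))) : ratSymmC v hZ y = -y := by
  have hle : cyclicSpan (thetaC θ) (fun i => (v i : ℂ)) ≤
      LinearMap.eqLocus (ratSymmC v hZ) (-LinearMap.id) := by
    rw [cyclicSpan, Submodule.span_le]
    rintro _ ⟨k, rfl⟩
    simp only [SetLike.mem_coe, LinearMap.mem_eqLocus, LinearMap.neg_apply, LinearMap.id_apply]
    rw [← ratCast_pow_toLin'_apply]
    exact ratSymmC_ratCast_of_mem hZ (pow_apply_mem_cyclicSpan _ v k)
  have h := hle hy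
  rwa [LinearMap.mem_eqLocus, LinearMap.neg_apply, LinearMap.id_apply] at h

/-- Pairing an `e`-eigenvector of `θ_ℂ` against `ℂ[θ_ℂ]·y₀`: orthogonality to `y₀` suffices.
[cite: Lang2002, Ch. XV §6–§7 (symmetric operators)] -/
theorem k3Form_eq_zero_of_mem_cyclicSpan_of_eigen
    (hθsa : ∀ a b : K3Index → ℂ, k3Form (thetaC θ a) b = k3Form a (thetaC θ b))
    {e : ℂ} {x y₀ y : K3Index → ℂ} (hx : thetaC θ x = e • x)
    (hy : y ∈ cyclicSpan (thetaC θ) y₀) (h0 : k3Form y₀ x = 0) : k3Form y x = 0 := by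
  obtain ⟨p, rfl⟩ := exists_aeval_apply_eq_of_mem_cyclicSpan _ _ hy
  have h := aeval_selfAdjoint k3FormC (f := thetaC θ) (fun a b => by simpa using hθsa a b) p y₀ x
  simp only [k3FormC_apply] at h
  rw [h, aeval_apply_of_eigen hx, k3Form_smul_right, h0, mul_zero]

variable {e : ℂ} {π : ℂ[X]}

/-- The model vector `w_u := π(θ_ℂ)(θ_ℂ u)` attached to a rational `u`: an `e`-eigenvector of `θ_ℂ` in
the complex cyclic subspace of `v = θ u`. [cite: GeemenSchutt2023, §2.1] -/
def modelVec (θ : Matrix K3Index K3Index ℚ) (π : ℂ[X]) (u : K3Index → ℚ) : K3Index → ℂ :=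
  aeval (thetaC θ) π (thetaC θ (fun i => (u i : ℂ)))

/-- `w_u = π(θ_ℂ)(v)`, `v = θ u` cast to `Λ_ℂ`. [cite: GeemenSchutt2023, §2.1] -/
theorem modelVec_eq_aeval (u : K3Index → ℚ) :
    modelVec θ π u = aeval (thetaC θ) π (fun i => (θ.mulVec u i : ℂ)) := by
  rw [modelVec, thetaC_ratCast]

/-- `w_u ∈ ℂ[θ_ℂ]·(θ u)`. [cite: Lang2002, Ch. XIV §2] -/
theorem modelVec_mem_cyclicSpan (u : K3Index → ℚ) :
    modelVec θ π u ∈ cyclicSpan (thetaC θ) (fun i => (θ.mulVec u i : ℂ)) := by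
  rw [modelVec_eq_aeval]
  exact aeval_apply_mem_cyclicSpan _ _ π

/-- `k3Form` is additive in the second variable (subtraction form). [folklore] -/
theorem k3Form_sub_right' (a b c : K3Index → ℂ) : k3Form a (b - c) = k3Form a b - k3Form a c := by
  rw [← k3FormC_apply, map_sub, k3FormC_apply, k3FormC_apply]

/-! ### §5 Non-degeneracy of `Z_{θu}` and the action of `R_{θu} ⊗ ℂ` on the `e`-eigenspace -/

/-- **`k3FormRat` is non-degenerate on `Z_v`, `v = θ u`**, as soon as the model vector `w_u` is
non-isotropic and the rational vectors of `θ(Λ_ℚ)` orthogonal to the `e`-eigenspace of `θ_ℂ` contain no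
non-zero isotropic vector (`hT`; in the application: Hodge index). [cite: Huybrechts2016K3, Ch. 3 Lemma 3.1 (p. 62–63)] -/
theorem nondegenerate_restrict_cycQ
    (hθsa : ∀ a b : K3Index → ℂ, k3Form (thetaC θ a) b = k3Form a (thetaC θ b))
    (hπe : π.eval e = 1)
    (hπW : ∀ y : K3Index → ℂ, thetaC θ (aeval (thetaC θ) π (thetaC θ y)) = e • aeval (thetaC θ) π (thetaC θ y))
    (hT : ∀ z : K3Index → ℚ, z ∈ LinearMap.range (Matrix.toLin' θ) →
      (∀ x : K3Index → ℂ, thetaC θ x = e • x → k3Form (fun i => (z i : ℂ)) x = 0) →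
      k3FormRat z z = 0 → z = 0)
    (u : K3Index → ℚ) (hw : k3Form (modelVec θ π u) (modelVec θ π u) ≠ 0) :
    (k3FormRat.restrict (cycQ θ (θ.mulVec u))).Nondegenerate := by
  set v : K3Index → ℚ := θ.mulVec u with hv
  set w := modelVec θ π u with hwdef
  have hweig : thetaC θ w = e • w := hπW _
  have key : ∀ a : cycQ θ v, (∀ b : cycQ θ v, k3FormRat a b = 0) → a = 0 := by
    intro a ha
    obtain ⟨z, hz⟩ := a
    simp only [Submodule.mk_eq_zero]
    -- (1) `z ⊥ ℂ[θ_ℂ]·v`, in particular `z ⊥ w`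
    have h1 : ∀ y ∈ cyclicSpan (thetaC θ) (fun i => (v i : ℂ)), k3Form (fun i => (z i : ℂ)) y = 0 := by
      intro y hy
      have hle : cyclicSpan (thetaC θ) (fun i => (v i : ℂ)) ≤
          LinearMap.ker (k3FormC (fun i => (z i : ℂ))) := by
        rw [cyclicSpan, Submodule.span_le]
        rintro _ ⟨k, rfl⟩
        simp only [SetLike.mem_coe, LinearMap.mem_ker]
        rw [← ratCast_pow_toLin'_apply, k3FormC_ratCast, Rat.cast_eq_zero]
        exact ha ⟨_, pow_apply_mem_cyclicSpan _ v k⟩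
      have h := hle hy
      rwa [LinearMap.mem_ker, k3FormC_apply] at h
    have h2 : k3Form (fun i => (z i : ℂ)) w = 0 := h1 w (modelVec_mem_cyclicSpan u)
    -- (2) `z = p(θ_ℂ) v`, so `π(θ_ℂ) z = p(e) w`
    obtain ⟨p, hp⟩ := exists_aeval_apply_eq_of_mem_cyclicSpan _ _ (ratCast_mem_cyclicSpan_of_mem hz)
    have h4 : aeval (thetaC θ) π (fun i => (z i : ℂ)) = p.eval e • w := by
      rw [← hp, ← Module.End.mul_apply, ← map_mul, mul_comm, map_mul, Module.End.mul_apply,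
        ← modelVec_eq_aeval, ← hwdef, aeval_apply_of_eigen hweig]
    -- (3) `p(e) = 0`, hence `π(θ_ℂ) z = 0`
    have hsa := fun a b => aeval_selfAdjoint k3FormC (f := thetaC θ) (fun a b => by simpa using hθsa a b) π a b
    simp only [k3FormC_apply] at hsa
    have h5 : aeval (thetaC θ) π (fun i => (z i : ℂ)) = 0 := by
      have h := hsa (fun i => (z i : ℂ)) w
      rw [aeval_apply_of_eigen hweig, hπe, one_smul, h2, h4, k3Form_smul_left] at h
      have hpe : p.eval e = 0 := by
        rcases mul_eq_zero.1 h with h' | h'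
        · exact h'
        · exact absurd h' hw
      rw [h4, hpe, zero_smul]
    -- (4) `z ⊥` the `e`-eigenspace
    have h6 : ∀ x : K3Index → ℂ, thetaC θ x = e • x → k3Form (fun i => (z i : ℂ)) x = 0 := by
      intro x hx
      have hx' : aeval (thetaC θ) π x = x := by rw [aeval_apply_of_eigen hx, hπe, one_smul]
      rw [← hx', ← hsa, h5, k3Form_zero_left]
    -- (5) conclude by `hT`
    refine hT z ?_ h6 (ha ⟨z, hz⟩)
    exact cyclicSpan_le_range (Matrix.toLin' θ) u hz
  refine ⟨fun a ha => key a fun b => ?_, fun a ha => key a fun b => ?_⟩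
  · simpa using ha b
  · rw [k3FormRat_isSymm.eq]; simpa using ha b

/-- **`R_{θu} ⊗ ℂ` acts on the `e`-eigenspace of `θ_ℂ` as the reflection along the model vector `w_u`.**
[cite: Omeara1963, §42] [cite: Iversen1992, Ch. I §2 (2.1)] -/
theorem ratSymmC_apply_of_eigen
    (hθsa : ∀ a b : K3Index → ℂ, k3Form (thetaC θ a) b = k3Form a (thetaC θ b))
    (hπe : π.eval e = 1)
    (hπW : ∀ y : K3Index → ℂ, thetaC θ (aeval (thetaC θ) π (thetaC θ y)) = e • aeval (thetaC θ) π (thetaC θ y))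
    (u : K3Index → ℚ) (hZ : (k3FormRat.restrict (cycQ θ (θ.mulVec u))).Nondegenerate)
    (hw : k3Form (modelVec θ π u) (modelVec θ π u) ≠ 0)
    {x : K3Index → ℂ} (hx : thetaC θ x = e • x) :
    ratSymmC (θ.mulVec u) hZ x = reflection k3FormC (modelVec θ π u) x := by
  set v : K3Index → ℚ := θ.mulVec u with hv
  set w := modelVec θ π u with hwdef
  have hweig : thetaC θ w = e • w := hπW _
  set c : ℂ := k3Form w x / k3Form w w with hc
  set x' := x - c • w with hx'def
  have hx'eig : thetaC θ x' = e • x' := by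
    rw [hx'def, map_sub, map_smul, hx, hweig, smul_sub, smul_comm]
  have hwx' : k3Form w x' = 0 := by
    rw [hx'def, k3Form_sub_right', k3Form_smul_right, hc, div_mul_cancel₀ _ hw, sub_self]
  have hsa := fun a b => aeval_selfAdjoint k3FormC (f := thetaC θ) (fun a b => by simpa using hθsa a b) π a b
  simp only [k3FormC_apply] at hsa
  have hvx' : k3Form (fun i => (v i : ℂ)) x' = 0 := by
    have h := hsa (fun i => (v i : ℂ)) x'
    rw [aeval_apply_of_eigen hx'eig, hπe, one_smul, ← modelVec_eq_aeval, ← hwdef, hwx'] at h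
    exact h.symm
  have hx'orth : x' ∈ orthC (cycQ θ v) := by
    rw [mem_orthC]
    intro z hz
    exact k3Form_eq_zero_of_mem_cyclicSpan_of_eigen hθsa hx'eig (ratCast_mem_cyclicSpan_of_mem hz) hvx'
  have h1 : ratSymmC v hZ x' = x' := ratSymmC_apply_of_mem_orthC hZ hx'orth
  have h2 : ratSymmC v hZ w = -w := ratSymmC_apply_of_mem_cyclicSpan hZ (modelVec_mem_cyclicSpan u)
  have hxdec : x = x' + c • w := by rw [hx'def, sub_add_cancel]
  have hrefl : reflection k3FormC w x = x - (2 * c) • w := by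
    rw [reflection_apply, k3FormC_apply, k3FormC_apply, hc]
    congr 1
    ring
  rw [hrefl]
  conv_lhs => rw [hxdec]
  rw [map_add, map_smul, h1, h2, hx'def, smul_neg, two_mul, add_smul]
  abel

end K3

end Summit.HodgeConjecture.HodgeConjecture.Theorems.MarkmanPartnerTransport.RMTypeOrbit

end
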